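/-
Origin: expansion seat `prover-pub-hodgecm-mc-binder-2-0`, handover #1 2026-08-18T17:2xZ md5 469f42d30645 (STATUS-only HANDOVER relayed L5177 model2-g2; packager row) (`HOME/mc/pub-hodgecm-mc-binder-2/lean/McBinder2/StructuralBinders.lean`, md5 469f42d3, 209 lines);
landed by the packager successor (mc-unitary-1-g3, gen-8 kit) in gate run 32 as `HodgeCM/Model/Binders/Structural.lean` (verbatim).
-/
/-
Origin: HOME/mc/pub-hodgecm-mc-binder-2/lean/McBinder2/StructuralBinders.lean — session prover-pub-hodgecm-mc-binder-2-0
(unit pub-hodgecm-mc-binder-2, MODEL-CONSTRUCTION sub-cell, BINDER PROVER for `h12b` + the structural binders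
`Pc`, `h07`, `h09a`, `h09b`, `hM38`).  Intended final place: `HodgeCM/Model/Binders/Structural.lean`
(tree target `Summits/HodgeConjecture/PerL/Model/Binders/Structural.lean`, class S, when the packager migrates).
Imports only LANDED package modules (gate run ≤ 31).  Nothing is posited, nothing is cited; no statement of PerL is
proved or refuted here — this file is the by-name DISCHARGE RECORD of the two model-independent binders and the
transport lemma that fixes the meaning of `Pc` inside `A12`/`A34`.
-/
import Summits.HodgeConjecture.HodgeCM.PerL34.EndStateThm44
import Summits.HodgeConjecture.HodgeCM.PerL34.N12bSignRecipe
import Summits.HodgeConjecture.HodgeCM.PerL34.S4Strength_2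

/-!
# The STRUCTURAL binders of the END STATE `EndStateThm44.endState_conclusions` — discharge record

The theorem of record `HodgeCM.PerL34.EndStateThm44.endState_conclusions` (`PerL34/EndStateThm44.lean:199`) has the
binders `(M : U.ModelAxioms) (T : U.ThetaModel) h07 h09a h09b hM38 hAlb h12b hbr hQ Pc A12 A34 hch hW`.  The seven
NON-PRINT binders `hAlb hbr hQ A12 A34 hch hW` are BINDER-TRIAGE.md's subject (model1/model2, mc-binder-1).  This file
settles the status of the other six NAMED binders ("h12b and the structural binders"), by name, in the kernel:

| binder | type | status | decl(s) |
|---|---|---|---|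
| `h12b` | `N12b_signRecipe T` (`= T.Design_kappaConj ∧ T.Design_frameSignConj`, `PerL34/Allowed.lean:51`) | **DISCHARGED for every model re-signed with PerL's recipe** (no hypothesis) | `h12b_discharged` below = `PerL34.N12b_signRecipe_withSignRecipe` (`N12bSignRecipe.lean:74`); for a model whose sign data already IS the recipe `h12b_of_eq` = `N12b_signRecipe_of_eq` (:69); underlying theorems `SignRecipe.kappa_conjugate` (`Automorphic/SignRecipe.lean:360`), `SignRecipe.frameSign_conjugate` (:229); END-STATE form `Universe.AdelicThetaCore.design_kappaConj/design_frameSignConj` (`SignRecipeEndState.lean:101/:105`) |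
| `Pc` | `∀ V c, C4a.PointedCore (T.core V c)` | **DISCHARGED for every model** (Hahn–Banach) | `Pc_discharged` below = `Universe.ThetaModel.pointedCores` (`PerL34/S4Strength.lean:558`) = `ArchC.PointedCore.ofDual` (:357); canonical END-STATE datum with GEOMETRIC points `Pt := G_U ⧸ Γ_U`: `Universe.AdelicTorusCore.pointedCore` (`Automorphic/EndStateInvariance.lean:168`) |
| `h07` | `N07_hodgeRiemann20 U = U.Fact_hodgeRiemann20` (`Automorphic/ThetaFacts.lean:86`) | UNIVERSE-side PRINT fact (Voisin, *Hodge Theory I*, Thm 6.32, p. 128) — NOT a property of `T`; independent of `ModelAxioms` + open inputs (`ToyG2.NoEndState3.not_imp_hodgeRiemann20_of_modelAxioms_openInputs`) | waits on the geometric universe: MODEL-SCOPE.md B.1 **G10** (via the G2/G3 dictionary; tree kernel analogues `Literature/HodgeTheory/HodgeIndexPrimitiveAlgebraicHolds.lean:165 hodgeIndex_surface_holds`, `HodgeRiemannPolarizabilityProofs.lean:533 hodgeRiemann_X`) |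
| `h09a`, `h09b` | `N09a_embCover T = T.Fact_embCover`, `N09b_innerEmb T = T.Fact_innerEmb` (`ThetaFacts.lean:109/:124`) | PRINT-interface facts about the DATA `emb`, `cover`, `HG` (Borel–Wallach VII Thm 3.2 pp. 142–143, 3.5 p. 144, 3.6 p. 145; Rogawski 1990 §15.1–15.3) | wait on MODEL-SCOPE.md B.1 **T2** = A.2 **O2/O4** (the Matsushima embedding `emb` + `cover`; MISSING-large); invariant under re-signing (`N09a/N09b_withSignRecipe_iff`, `N12bSignRecipe.lean:77/:78`); toy sanity instances `ToyG2.thetaModel₃_embCover/innerEmb` (`Model/ToyG2/ThetaModelEmb3.lean:128/:137`) |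
| `hM38` | `U.Fact_cmInflation` (`PerL34/ThetaSubOfLiu.lean:158`) | UNIVERSE-side PRINT fact (Shimura 1998 §6.2 Thm 3 + §6.1 Thm 2 Cor., verbatim quotes in the docstring) — NOT a property of `T`; independent of `ModelAxioms` (`Toy.cmInflation_independent`) | waits on MODEL-SCOPE.md B.1 **G12** (CM abelian varieties `ℂ^Φ/Φ(𝔞)` as objects of `U.Var` with `K`-action on `H¹`; MISSING-large) |

What is NEW here (small, structural):

* `ArchCDatum.comapPoints` / `ArchCDatum.restrictPoints` — the Lemma-4.1(c) record is CONTRAVARIANT in the point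
  datum: a chart over the Hahn–Banach points `PointedCore.ofDual C` restricts to a chart over ANY
  `P : C4a.PointedCore C` (the two fields that read `P` — `pure_detect`, `inf_invariance` — are specialised to the
  functionals `P.evalPt p`).  Hence among all choices of the free binder `Pc`, the Hahn–Banach one makes `A12`/`A34`
  STRONGEST, and the geometric one (`AdelicTorusCore.pointedCore`, point evaluations of `[G_U]`) is what the intended
  model supplies; `Pc` is free as a binder but is NOT "w.l.o.g. Hahn–Banach" inside `A12`/`A34`
  (`archC_of_hahnBanach` goes one way only).
* `endState_conclusions_structural` — the END STATE with `h12b` and `Pc` GONE: eleven named binders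
  (`M`, the bit `h`, `h07 h09a h09b hM38` PRINT, `hAlb hbr hQ A12 A34 hch hW` for the re-signed model
  `T.withSignRecipe h` over its Hahn–Banach points).  This is the binder list the MODEL-CONSTRUCTION sub-cell has to
  serve: every remaining binder is either a Universe-side print fact (h07, hM38), a print fact about the data
  `emb`/`cover` (h09a/b), or one of BINDER-TRIAGE's seven.
-/

noncomputable section

namespace HodgeCM

/-! ## §1 `Pc` inside `A12`/`A34`: the record `ArchCDatum` is contravariant in the point datum -/

namespace PerL34.ArchC

open HodgeCM.Prior.Perl34File HodgeCM.Prior.Perl34File.Perl34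

section Restrict

variable {H HG G SK SigIdx SigIdxG : Type*} {CG : Type}
variable [NormedAddCommGroup H] [InnerProductSpace ℂ H] [CompleteSpace H]
variable [NormedAddCommGroup HG] [InnerProductSpace ℂ HG] [CompleteSpace HG]
variable [NormedAddCommGroup CG] [NormedSpace ℂ CG]
variable [Group G] [TopologicalSpace G] [TopologicalSpace SK]
variable {C : IsolationCore H HG CG G SK SigIdx SigIdxG} {D : TorusData C}

/-- **Pull-back of a Lemma-4.1(c) chart along a map of point data.**  If the points of `P` evaluate through
functionals that are among the points of `Q` (`P.evalPt p = Q.evalPt (f p)`), a chart over `Q` restricts to one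
over `P`: every field of `ArchCDatum` not mentioning the point datum is kept verbatim, and the two fields that
quantify over points (`pure_detect`, `inf_invariance`) are specialised along `f`. -/
def ArchCDatum.comapPoints {P Q : C4a.PointedCore C} (f : P.Pt → Q.Pt)
    (hf : ∀ p : P.Pt, P.evalPt p = Q.evalPt (f p)) (A : ArchCDatum C D Q) : ArchCDatum C D P where
  F := A.F
  ιX := A.ιX
  X := A.X
  Tg := A.Tg
  ιT := A.ιT
  w := A.w
  w_norm := A.w_norm
  ωT := A.ωT
  FinIdx := A.FinIdx
  ins := A.ins
  φ₀ := A.φ₀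
  Sm := A.Sm
  Y := A.Y
  ins_add := A.ins_add
  ins_smul := A.ins_smul
  omg_ins := A.omg_ins
  invariance := A.invariance
  pure_detect := fun Φ p v h => by
    rw [hf p] at h ⊢
    exact A.pure_detect Φ (f p) v h
  Sm_sub := A.Sm_sub
  Sm_dense := A.Sm_dense
  Y_mem := A.Y_mem
  inf_invariance := fun g p k φ i v hv => by
    rw [hf p]
    exact A.inf_invariance g (f p) k φ i v hv
  gen := A.gen
  φ₀_eigen := A.φ₀_eigen
  wOccurs_of_eigenvector := A.wOccurs_of_eigenvector

/-- **The Hahn–Banach point datum is the STRONGEST choice of `Pc` inside `A12`/`A34`:** a chart over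
`PointedCore.ofDual C` (points := all continuous functionals of `C([G_U])`, `S4Strength`) restricts to a chart over
every point datum `P` (take `f := P.evalPt`). -/
def ArchCDatum.restrictPoints (P : C4a.PointedCore C) (A : ArchCDatum C D (PointedCore.ofDual C)) :
    ArchCDatum C D P :=
  ArchCDatum.comapPoints (Q := PointedCore.ofDual C) (fun p => P.evalPt p) (fun _ => rfl) A

/-- `Nonempty` form of `ArchCDatum.restrictPoints`. -/
theorem archC_of_hahnBanach (P : C4a.PointedCore C) (h : Nonempty (ArchCDatum C D (PointedCore.ofDual C))) :
    Nonempty (ArchCDatum C D P) :=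
  h.map (ArchCDatum.restrictPoints P)

end Restrict

end PerL34.ArchC

/-! ## §2 The two model-independent binders, by name -/

namespace Model.Binders

open HodgeCM.PerL34 HodgeCM.PerL34.ArchC
open HodgeCM.Prior.Perl34File HodgeCM.Prior.Perl34File.Perl34
open HodgeCM.Universe (ThetaModel)

variable {U : Universe}

/-- **`h12b` DISCHARGED** for every theta model re-signed with PerL's sign recipe (`kappa := SignRecipe.kappa h`,
`frameSign := SignRecipe.frameSign`; `h` = the convention bit `φ^h ∈ {1, c}` of (eq:Phiprime)); no hypothesis.
By name: `PerL34.N12b_signRecipe_withSignRecipe`. -/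
theorem h12b_discharged (T : U.ThetaModel) (h : Bool) : N12b_signRecipe (T.withSignRecipe h) :=
  N12b_signRecipe_withSignRecipe T h

/-- **`h12b` for a model whose sign data already IS PerL's recipe** (as in every END-STATE model of the package,
`Universe.AdelicThetaCore.toCore`: `SignRecipeEndState.lean:78–79`).  By name: `PerL34.N12b_signRecipe_of_eq`. -/
theorem h12b_of_eq (T : U.ThetaModel) (h : Bool) (hk : T.kappa = SignRecipe.kappa h)
    (hf : T.frameSign = SignRecipe.frameSign) : N12b_signRecipe T :=
  N12b_signRecipe_of_eq T h hk hf

/-- **`Pc` DISCHARGED** for every theta model: the Hahn–Banach point datum (points := the continuous dual of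
`C([G_U])`, separation := `SeparatingDual`).  By name: `Universe.ThetaModel.pointedCores`. -/
def Pc_discharged (T : U.ThetaModel) {L : CMField} {ι₁ : L →+* ℂ} (V : HermSpace3 L ι₁) (c : SeesawCtx L) :
    C4a.PointedCore (T.core V c) :=
  T.pointedCores V c

/-- The Hahn–Banach `Pc` makes `A12`/`A34` strongest: a model serving them over `Pc_discharged` serves them over
every point datum (in particular over the geometric points of the END STATE). -/
theorem A_of_hahnBanach (T : U.ThetaModel) {L : CMField} {ι₁ : L →+* ℂ} (V : HermSpace3 L ι₁) (c : SeesawCtx L)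
    (Dsel : TorusData (T.core V c)) (P : C4a.PointedCore (T.core V c))
    (hA : Nonempty (ArchCDatum (T.core V c) Dsel (Pc_discharged T V c))) :
    Nonempty (ArchCDatum (T.core V c) Dsel P) :=
  archC_of_hahnBanach P hA

/-! ## §3 The END STATE with the two structural binders gone (13 → 11 named binders) -/

/-- **`EndStateThm44.endState_conclusions` with `h12b` and `Pc` DISCHARGED.**  Binders: the model facts `M`, ANY
theta model `T` and the convention bit `h`; the four PRINT binders `h07`, `h09a`, `h09b` (about `T.emb`/`T.cover`
— literally the same statements for `T` and its re-signing), `hM38`; and BINDER-TRIAGE's seven, stated for the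
re-signed model `T.withSignRecipe h` (whose good contexts carry PerL's ACTUAL forced signs) over its Hahn–Banach
points.  Conclusions: Thm 4.4 as printed, the wall `W^L_per`, both realisation inputs, rfwf Thm 4.1 over `F`,
`W_RK4`, `W^L_Alb` (both forms). -/
theorem endState_conclusions_structural (M : U.ModelAxioms) (T : U.ThetaModel) (h : Bool)
    (h07 : N07_hodgeRiemann20 U) (h09a : N09a_embCover T) (h09b : N09b_innerEmb T)
    (hM38 : U.Fact_cmInflation) (hAlb : (T.withSignRecipe h).Fact_thetaAlbanese)
    (hbr : ∀ {L : CMField} {ι₁ : L →+* ℂ} (V : HermSpace3 L ι₁) (c : SeesawCtx L),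
      (T.withSignRecipe h).GoodCtx ι₁ c →
      Nonempty (SeesawDictionary.SeesawBridge (T.withSignRecipe h) V c ((T.withSignRecipe h).t12 V c) 0 1))
    (hQ : ∀ {L : CMField} {ι₁ : L →+* ℂ} (V : HermSpace3 L ι₁) (c : SeesawCtx L),
      (T.withSignRecipe h).GoodCtx ι₁ c →
      Nonempty (QautDictionary.QautBridge (T.withSignRecipe h) V c ((T.withSignRecipe h).t34 V c) 2 3))
    (A12 : ∀ {L : CMField} {ι₁ : L →+* ℂ} (V : HermSpace3 L ι₁) (c : SeesawCtx L),
      (T.withSignRecipe h).GoodCtx ι₁ c →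
      Nonempty (ArchCDatum ((T.withSignRecipe h).core V c) ((T.withSignRecipe h).t12 V c)
        (Pc_discharged (T.withSignRecipe h) V c)))
    (A34 : ∀ {L : CMField} {ι₁ : L →+* ℂ} (V : HermSpace3 L ι₁) (c : SeesawCtx L),
      (T.withSignRecipe h).GoodCtx ι₁ c →
      Nonempty (ArchCDatum ((T.withSignRecipe h).core V c) ((T.withSignRecipe h).t34 V c)
        (Pc_discharged (T.withSignRecipe h) V c)))
    (hch : (T.withSignRecipe h).Open_chars) (hW : CharSpansFinal.WeilStepsInputCRΔ (T.withSignRecipe h)) :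
    U.PerL44 ∧ U.PerL ∧ (U.RealisationExistsPerL ∧ U.RealisationExistsFace) ∧ U.PeriodThmF ∧ U.W_RK4 ∧
      WAlb.WLAlb44 U ∧ WAlb.WLAlb U :=
  EndStateThm44.endState_conclusions M (T.withSignRecipe h) h07 ((N09a_withSignRecipe_iff T h).2 h09a)
    ((N09b_withSignRecipe_iff T h).2 h09b) hM38 hAlb (h12b_discharged T h) hbr hQ
    (fun V c => Pc_discharged (T.withSignRecipe h) V c) A12 A34 hch hW

/-- **Same, for a model whose sign data already IS the recipe** (the END-STATE models of the package): twelve named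
binders over `T` itself, `Pc` := Hahn–Banach points. -/
theorem endState_conclusions_of_eq (M : U.ModelAxioms) (T : U.ThetaModel) (h : Bool)
    (hk : T.kappa = SignRecipe.kappa h) (hf : T.frameSign = SignRecipe.frameSign)
    (h07 : N07_hodgeRiemann20 U) (h09a : N09a_embCover T) (h09b : N09b_innerEmb T)
    (hM38 : U.Fact_cmInflation) (hAlb : T.Fact_thetaAlbanese)
    (hbr : ∀ {L : CMField} {ι₁ : L →+* ℂ} (V : HermSpace3 L ι₁) (c : SeesawCtx L), T.GoodCtx ι₁ c →
      Nonempty (SeesawDictionary.SeesawBridge T V c (T.t12 V c) 0 1))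
    (hQ : ∀ {L : CMField} {ι₁ : L →+* ℂ} (V : HermSpace3 L ι₁) (c : SeesawCtx L), T.GoodCtx ι₁ c →
      Nonempty (QautDictionary.QautBridge T V c (T.t34 V c) 2 3))
    (A12 : ∀ {L : CMField} {ι₁ : L →+* ℂ} (V : HermSpace3 L ι₁) (c : SeesawCtx L),
      T.GoodCtx ι₁ c → Nonempty (ArchCDatum (T.core V c) (T.t12 V c) (Pc_discharged T V c)))
    (A34 : ∀ {L : CMField} {ι₁ : L →+* ℂ} (V : HermSpace3 L ι₁) (c : SeesawCtx L),
      T.GoodCtx ι₁ c → Nonempty (ArchCDatum (T.core V c) (T.t34 V c) (Pc_discharged T V c)))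
    (hch : T.Open_chars) (hW : CharSpansFinal.WeilStepsInputCRΔ T) :
    U.PerL44 ∧ U.PerL ∧ (U.RealisationExistsPerL ∧ U.RealisationExistsFace) ∧ U.PeriodThmF ∧ U.W_RK4 ∧
      WAlb.WLAlb44 U ∧ WAlb.WLAlb U :=
  EndStateThm44.endState_conclusions M T h07 h09a h09b hM38 hAlb (h12b_of_eq T h hk hf) hbr hQ
    (fun V c => Pc_discharged T V c) A12 A34 hch hW

end Model.Binders

end HodgeCM

end
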